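import Summits.QuantumFields.BalabanUV.Beta.GAN24.CapacitanceSolve

/-!
# `BalabanUV.Beta.GAN24.CapacitanceSolveForm` — binder row G-an2-4 / (CONV-C), road P1-fibre: the QUADRATIC-FORM STRUCTURE of the abstract alias sum
# `CapacitanceSolve.capP` at conjugate-symmetric («real momentum») data — `𝒫` is HERMITIAN-PSD (SKELETON-P1 S1b′), the sign structure leaf P1-L08 (A4) starts from

NOT IN PRINT; OUR PROOF ATTEMPT.  HONEST FRAMING (cell contract, verbatim): «discharging `BetaPertH` makes Bałaban's UV stability UNCONDITIONAL — a real
constructive-QFT result; it is NOT the continuum limit and NOT the Clay problem.»  HONEST DEPENDENCY (verbatim): «continuum YM on T⁴ ⇐ BetaPertH ∧ nine spine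
estimates (0/9 proved); BetaPertH ⇐ (D1) ∧ (D4) ∧ CAP+tail; G-an2-4 gates asym, D1 and NE2/3/4.»  [folklore] finite-dimensional algebra over `ℂ` + Cauchy–Schwarz
(no estimate uniform in anything, no cited fact, no wall binder, no `def … : Prop` hypothesis: the `[shape]` predicate carries its data as parameters and is asserted
of nothing).  NOT summit progress; nothing of (CONV-C)'s K-slot is discharged here.

## What is proved
In `GAN24/CapacitanceSolve` (p200566) the `φφ` block of the capacitance matrix is the abstract alias sum
`capP κ l = Σ_m wQ_{mκ} (δ_{κl} − ∂_{mκ}∂♭_{ml}/L_m) wE_{ml} /(2L_m)`.  At REAL coarse momentum the S1a data are conjugate-symmetric: `∂♭_m = conj ∂_m` and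
`wQ_{mκ}·wE_{ml} = r_m σ_{mκ} conj(σ_{ml})` with `r_m ≥ 0` (S1a: `r_m = |S(m)|²/N^D`, `σ_m = s(m)`; S1b′: «`S_mχ̂_m = |S_m|²/N^D ≥ 0`») — packaged as the `[shape]`
predicate `ConjData F r σ`.  THEN (`quadForm_capP_eq`) for every `ξ : Fin D → ℂ`
  `Σ_{κ,l} conj(ξ_κ)·capP κ l·ξ_l = Σ_m (r_m/(2L_m))·(Σ_κ conj(η_{mκ})η_{mκ} − conj(B_m)·B_m/L_m)`,  `η_{ml} = conj(σ_{ml})ξ_l`, `B_m = Σ_l conj(∂_{ml})η_{ml}`,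
with `L_m = Σ_κ |∂_{mκ}|² > 0` (`L_eq_normSq`, `normSqSum_pos`; `Complex.conj_mul'` BY NAME); by Cauchy–Schwarz `|B_m|² ≤ L_m Σ_κ|η_{mκ}|²` (`normSq_pair_le`) every summand is a NONNEGATIVE REAL,
so the form is real and `≥ 0` (`quadForm_capP_real_nonneg`): `capP` is Hermitian positive semi-definite — King's/p3's «pivot `QGQ*` with the TRANSVERSE propagator
`Π⊥/(2L)`».  The N-UNIFORM LOWER bound on the transverse directions (leaf P1-L08, A4(ii)) is NOT proved here; this file supplies only the exact quadratic-form identity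
it starts from.
v1.1 (append-only): `capW_eq_conj_capV` — with the Q/G and M/EL weights factoring through the same `(r, σ)`, `capW = conj ∘ capV`: the bordered matrix
`[[𝒫, 𝓋],[𝓌ᵀ, 0]]` is Hermitian.
-/

open Finset
open scoped BigOperators ComplexConjugate

namespace Summit.QuantumFields.BalabanUV.Beta.GAN24.CapacitanceSolveForm

open FibreBlockSolve (dot)
open CapacitanceSolve

variable {D : ℕ} {ι : Type*}

/-- [shape] CONJUGATE-SYMMETRIC («real momentum») fibre data: `∂♭ = conj ∂` and the Q/EL border weights factor as `wQ_{mκ} wE_{ml} = r_m σ_{mκ} conj(σ_{ml})` with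
`r_m ≥ 0`.  Asserted of nothing. -/
structure ConjData (F : Fibre D ι) (r : ι → ℝ) (σ : ι → Fin D → ℂ) : Prop where
  /-- `∂̂♭(k_m) = conj ∂̂(k_m)` (real fine momenta) -/
  db_conj : ∀ m κ, F.db m κ = conj (F.dd m κ)
  /-- `wQ_{mκ} wE_{ml} = r_m σ_{mκ} conj(σ_{ml})` (S1a: `S(m)s_κ(m) · χ̂(m)s♭_l(m)` with `χ̂(m) = conj S(m)/N^D`) -/
  weights : ∀ m κ l, F.wQ m κ * F.wE m l = (r m : ℂ) * σ m κ * conj (σ m l)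
  /-- `r_m ≥ 0` (S1a: `|S(m)|²/N^D`) -/
  r_nonneg : ∀ m, 0 ≤ r m

variable (F : Fibre D ι)

/-- [folklore] At conjugate-symmetric data the Laplacian symbol is the squared norm of the difference symbol: `L_m = Σ_κ |∂_{mκ}|²`. -/
theorem L_eq_normSq {r : ι → ℝ} {σ : ι → Fin D → ℂ} (h : ConjData F r σ) (m : ι) :
    F.L m = ((∑ κ, ‖F.dd m κ‖ ^ 2 : ℝ) : ℂ) := by
  rw [← F.dot_db_dd m]
  unfold dot
  push_cast
  exact Finset.sum_congr rfl fun κ _ => by rw [h.db_conj m κ]; exact Complex.conj_mul' _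

/-- [folklore] … and it is a POSITIVE real (`L_m ≠ 0` is part of `Fibre`). -/
theorem normSqSum_pos {r : ι → ℝ} {σ : ι → Fin D → ℂ} (h : ConjData F r σ) (m : ι) : 0 < ∑ κ, ‖F.dd m κ‖ ^ 2 := by
  have hne : (∑ κ, ‖F.dd m κ‖ ^ 2 : ℝ) ≠ 0 := by
    intro h0
    have := F.L_ne m
    rw [L_eq_normSq F h m, h0] at this
    exact this (by simp)
  exact lt_of_le_of_ne (Finset.sum_nonneg fun κ _ => by positivity) (Ne.symm hne)

/-- [folklore] CAUCHY–SCHWARZ for the pairing `B = Σ_l conj(∂_l) η_l`: `|B|² ≤ (Σ_l |∂_l|²)(Σ_l |η_l|²)`. -/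
theorem normSq_pair_le (dd η : Fin D → ℂ) :
    ‖∑ l, conj (dd l) * η l‖ ^ 2 ≤ (∑ l, ‖dd l‖ ^ 2) * ∑ l, ‖η l‖ ^ 2 := by
  have h1 : ‖∑ l, conj (dd l) * η l‖ ≤ ∑ l, ‖dd l‖ * ‖η l‖ := by
    refine (norm_sum_le _ _).trans (le_of_eq (Finset.sum_congr rfl fun l _ => ?_))
    rw [norm_mul, Complex.norm_conj]
  have h2 : (∑ l, ‖dd l‖ * ‖η l‖) ^ 2 ≤ (∑ l, ‖dd l‖ ^ 2) * ∑ l, ‖η l‖ ^ 2 :=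
    Finset.sum_mul_sq_le_sq_mul_sq _ _ _
  exact (pow_le_pow_left₀ (norm_nonneg _) h1 2).trans h2

/-- [folklore] PER-ALIAS QUADRATIC FORM of `capPm`: `Σ_{κ,l} conj(ξ_κ) capPm m κ l ξ_l = (r_m/(2L_m))·(Σ_κ conj(η_κ)η_κ − (Σ_κ ∂_κ conj η_κ)(Σ_l conj(∂_l) η_l)/L_m)`,
`η_l = conj(σ_{ml}) ξ_l`. -/
theorem quadForm_capPm_eq {r : ι → ℝ} {σ : ι → Fin D → ℂ} (h : ConjData F r σ) (m : ι) (ξ : Fin D → ℂ) :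
    ∑ κ, ∑ l, conj (ξ κ) * capPm F m κ l * ξ l
      = (r m : ℂ) / (2 * F.L m) *
          (∑ κ, conj (conj (σ m κ) * ξ κ) * (conj (σ m κ) * ξ κ)
            - (∑ κ, F.dd m κ * conj (conj (σ m κ) * ξ κ)) * (∑ l, conj (F.dd m l) * (conj (σ m l) * ξ l)) / F.L m) := by
  have e : ∀ κ l, conj (ξ κ) * capPm F m κ l * ξ l
      = (r m : ℂ) / (2 * F.L m) * ((if κ = l then conj (conj (σ m κ) * ξ κ) * (conj (σ m l) * ξ l) else 0)
          - F.dd m κ * conj (conj (σ m κ) * ξ κ) * (conj (F.dd m l) * (conj (σ m l) * ξ l)) / F.L m) := by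
    intro κ l
    have e1 : conj (ξ κ) * capPm F m κ l * ξ l
        = (F.wQ m κ * F.wE m l) * (((if κ = l then 1 else 0) - F.dd m κ * F.db m l / F.L m) / (2 * F.L m)) * (conj (ξ κ) * ξ l) := by
      unfold capPm; ring
    rw [e1, h.weights m κ l, h.db_conj m l]
    simp only [map_mul, Complex.conj_conj]
    split_ifs with hκl
    · subst hκl; ring
    · ring
  rw [Finset.sum_congr rfl fun κ _ => Finset.sum_congr rfl fun l _ => e κ l]
  simp only [← Finset.mul_sum]
  congr 1
  simp only [Finset.sum_sub_distrib, Finset.sum_ite_eq, Finset.mem_univ, if_true]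
  congr 1
  rw [Finset.sum_mul, Finset.sum_div]
  refine Finset.sum_congr rfl fun κ _ => ?_
  rw [Finset.mul_sum, Finset.sum_div]

/-- [folklore] **THE QUADRATIC FORM OF `capP`** at conjugate-symmetric data: `ξ* 𝒫 ξ = Σ_m (r_m/(2L_m))·(‖η_m‖² − |⟨∂_m, η_m⟩|²/L_m)` written over `ℂ`. -/
theorem quadForm_capP_eq [Fintype ι] {r : ι → ℝ} {σ : ι → Fin D → ℂ} (h : ConjData F r σ) (ξ : Fin D → ℂ) :
    ∑ κ, ∑ l, conj (ξ κ) * capP F κ l * ξ l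
      = ∑ m, (r m : ℂ) / (2 * F.L m) *
          (∑ κ, conj (conj (σ m κ) * ξ κ) * (conj (σ m κ) * ξ κ)
            - (∑ κ, F.dd m κ * conj (conj (σ m κ) * ξ κ)) * (∑ l, conj (F.dd m l) * (conj (σ m l) * ξ l)) / F.L m) := by
  have e1 : ∀ κ : Fin D, (∑ l : Fin D, ∑ m : ι, conj (ξ κ) * capPm F m κ l * ξ l)
      = ∑ m : ι, ∑ l : Fin D, conj (ξ κ) * capPm F m κ l * ξ l := fun κ => Finset.sum_comm
  have e : ∑ κ, ∑ l, conj (ξ κ) * capP F κ l * ξ l = ∑ m, ∑ κ, ∑ l, conj (ξ κ) * capPm F m κ l * ξ l := by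
    simp only [capP, Finset.mul_sum, Finset.sum_mul]
    rw [Finset.sum_congr rfl fun κ _ => e1 κ, Finset.sum_comm]
  rw [e]
  exact Finset.sum_congr rfl fun m _ => quadForm_capPm_eq F h m ξ

/-- [folklore] The per-alias summand as a REAL number: `(r_m/(2ℓ_m))·(a_m − b_m/ℓ_m)` with `ℓ_m = Σ|∂_{mκ}|²`, `a_m = Σ_κ|η_{mκ}|²`, `b_m = |B_m|²`. -/
theorem summand_eq_real {r : ι → ℝ} {σ : ι → Fin D → ℂ} (h : ConjData F r σ) (m : ι) (ξ : Fin D → ℂ) :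
    (r m : ℂ) / (2 * F.L m) *
        (∑ κ, conj (conj (σ m κ) * ξ κ) * (conj (σ m κ) * ξ κ)
          - (∑ κ, F.dd m κ * conj (conj (σ m κ) * ξ κ)) * (∑ l, conj (F.dd m l) * (conj (σ m l) * ξ l)) / F.L m)
      = ((r m / (2 * ∑ κ, ‖F.dd m κ‖ ^ 2) *
          ((∑ κ, ‖conj (σ m κ) * ξ κ‖ ^ 2) - ‖∑ l, conj (F.dd m l) * (conj (σ m l) * ξ l)‖ ^ 2 / ∑ κ, ‖F.dd m κ‖ ^ 2) : ℝ) : ℂ) := by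
  have hB : (∑ κ, F.dd m κ * conj (conj (σ m κ) * ξ κ)) = conj (∑ l, conj (F.dd m l) * (conj (σ m l) * ξ l)) := by
    rw [map_sum]
    exact Finset.sum_congr rfl fun κ _ => by simp only [map_mul, Complex.conj_conj]
  rw [hB, Complex.conj_mul', L_eq_normSq F h m]
  have hA : ∑ κ, conj (conj (σ m κ) * ξ κ) * (conj (σ m κ) * ξ κ) = ((∑ κ, ‖conj (σ m κ) * ξ κ‖ ^ 2 : ℝ) : ℂ) := by
    push_cast
    exact Finset.sum_congr rfl fun κ _ => Complex.conj_mul' _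
  rw [hA]
  push_cast
  ring

/-- [folklore] … and that real number is NONNEGATIVE (Cauchy–Schwarz, `r_m ≥ 0`, `ℓ_m > 0`). -/
theorem summand_real_nonneg {r : ι → ℝ} {σ : ι → Fin D → ℂ} (h : ConjData F r σ) (m : ι) (ξ : Fin D → ℂ) :
    0 ≤ r m / (2 * ∑ κ, ‖F.dd m κ‖ ^ 2) *
          ((∑ κ, ‖conj (σ m κ) * ξ κ‖ ^ 2) - ‖∑ l, conj (F.dd m l) * (conj (σ m l) * ξ l)‖ ^ 2 / ∑ κ, ‖F.dd m κ‖ ^ 2) := by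
  have hℓ := normSqSum_pos F h m
  refine mul_nonneg (div_nonneg (h.r_nonneg m) (by positivity)) ?_
  rw [sub_nonneg, div_le_iff₀ hℓ]
  have := normSq_pair_le (F.dd m) (fun l => conj (σ m l) * ξ l)
  linarith [this, mul_comm (∑ l, ‖F.dd m l‖ ^ 2) (∑ l, ‖conj (σ m l) * ξ l‖ ^ 2)]

/-- [folklore] **`capP` IS HERMITIAN POSITIVE SEMI-DEFINITE at conjugate-symmetric data**: for every `ξ`, the form `Σ_{κ,l} conj(ξ_κ) capP κ l ξ_l` is a nonnegative
real number (imaginary part `0`, real part `≥ 0`).  The N-uniform LOWER bound on transverse `ξ` (leaf P1-L08, A4(ii)) is a separate estimate, not claimed here. -/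
theorem quadForm_capP_real_nonneg [Fintype ι] {r : ι → ℝ} {σ : ι → Fin D → ℂ} (h : ConjData F r σ) (ξ : Fin D → ℂ) :
    (∑ κ, ∑ l, conj (ξ κ) * capP F κ l * ξ l).im = 0 ∧ 0 ≤ (∑ κ, ∑ l, conj (ξ κ) * capP F κ l * ξ l).re := by
  rw [quadForm_capP_eq F h ξ]
  simp only [summand_eq_real F h, Complex.im_sum, Complex.re_sum, Complex.ofReal_im, Complex.ofReal_re, Finset.sum_const_zero, true_and]
  exact Finset.sum_nonneg fun m _ => summand_real_nonneg F h m ξ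

/-- [folklore] **THE BORDER IS HERMITIAN**: if moreover the Q/G and M/EL weights factor through the same `(r, σ)` — `wQ_{mκ} wG_m = r_m σ_{mκ}` and
`wM_m wE_{mκ} = r_m conj(σ_{mκ})` (S1a at real `p`: `S s_κ · χ̂ = |S|² s_κ/N^D`, `S · χ̂ s♭_κ = |S|² conj(s_κ)/N^D`) — then `capW κ = conj (capV κ)` EXACTLY: the bordered
capacitance matrix `[[𝒫, 𝓋],[𝓌ᵀ, 0]]` of S1b′ is `[[𝒫, 𝓋],[𝓋*, 0]]`, Hermitian (so the longitudinal pinning quantity `𝓋_∥𝓌_∥` of A4′(iii) is `|𝓋_∥|²`). -/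
theorem capW_eq_conj_capV [Fintype ι] {r : ι → ℝ} {σ : ι → Fin D → ℂ} (h : ConjData F r σ)
    (hV : ∀ m κ, F.wQ m κ * F.wG m = (r m : ℂ) * σ m κ) (hW : ∀ m κ, F.wM m * F.wE m κ = (r m : ℂ) * conj (σ m κ)) (κ : Fin D) :
    capW F κ = conj (capV F κ) := by
  simp only [capW, capV, map_sum]
  refine Finset.sum_congr rfl fun m _ => ?_
  have hL : conj (F.L m) = F.L m := by rw [L_eq_normSq F h m, Complex.conj_ofReal]
  have e1 : F.wM m * F.db m κ * F.wE m κ / F.L m ^ 2 = (F.wM m * F.wE m κ) * F.db m κ / F.L m ^ 2 := by ring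
  have e2 : F.wQ m κ * F.dd m κ * F.wG m / F.L m ^ 2 = (F.wQ m κ * F.wG m) * F.dd m κ / F.L m ^ 2 := by ring
  rw [e1, e2, hW m κ, hV m κ, h.db_conj m κ, map_div₀, map_pow, hL, map_mul, map_mul, Complex.conj_ofReal]

end Summit.QuantumFields.BalabanUV.Beta.GAN24.CapacitanceSolveForm
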